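import Mathlib
import Summits.KontsevichZagierPeriods.KontsevichZagierPeriods.Theorems.SoloInformedTorsionMaster
import HarnessLib
import HarnessLib.Audit

/-!
# SoloInformed — the torsion chain, III: the two Beta lifts of the master representation

With `M_κ = [(0,1), κ · w^{−1/2} Q(w)^{−1/2}]`, `Q(w) = (1 − 2w)³ + w³`
(`SoloInformedTorsionMaster`; `= κ ∫ dX/y` on `y² = X³ + 1`, `w = 1/(X + 2)`), two rational
substitutions — both instances of Kontsevich–Zagier's rule 2, certified through the generic
one-variable lift lemma `soloInformed_lift_mem_changeOfVariablesRel` — identify the halves of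
`M₃` with Beta representations:

* **Lift 1** (`t = g₁(w) = ((2w − 1)/w)³ = −1/X³`, increasing on `(½,1)`):
  `⟦M₃|_{(½,1)}⟧ = ⟦β(⅓,½)⟧`, since `1 − g₁ = Q/w³` and
  `g₁^{−2/3}(1 − g₁)^{−1/2} g₁' = 3 w^{−1/2} Q^{−1/2}`;
* **Lift 2** (`t = g₂(w) = (1 − 2w)³/Q(w) = X³/(X³ + 1)`, decreasing on `(0,½)`):
  `⟦M₃|_{(0,½)}⟧ = ⟦β(⅓,⅙)⟧`, since `1 − g₂ = w³/Q` and
  `g₂^{−2/3}(1 − g₂)^{−5/6} |g₂'| = 3 w^{−1/2} Q^{−1/2}`.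

The integrand identities are proved by raising to the sixth power (`soloInformed_rpow_pow_six`),
after which they are rational identities (`field_simp`). Classically these are the evaluations
`∫_0^∞ dX/√(X³+1) = ⅓B(⅓,⅙)` and `∫_{−1}^0 dX/√(X³+1) = ⅓B(⅓,½)`.
Residency `solo-KontsevichZagierPeriods-informed` (s23); paper §6octies (vii).

References: Kontsevich–Zagier, *Periods* (2001), §1.2, rule 2; Andrews–Askey–Roy (1999),
Thm. 1.1.4 and Ex. 1.14 (Beta integrals of binomial type).
-/

noncomputable section

open MeasureTheory Set Filter
namespace Summit.KontsevichZagierPeriods.KontsevichZagierPeriods.Theorems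

open Literature.NumberTheory.Transcendental Literature.NumberTheory.Transcendental.KZ
open Literature.ModelTheory.ExponentialFields

/-! ### Lift 1: `M₃|_{(½,1)} → β(⅓,½)` by `g₁(w) = ((2w − 1)/w)³` -/

/-- `g₁(w) = (2w − 1)³ / w³` (`= −1/X³` in the curve coordinate). [this work] -/
def soloInformedTorsionG₁ (w : ℝ) : ℝ := (2 * w - 1) ^ 3 / w ^ 3

/-- `g₁'(w) = 3(2w − 1)² / w⁴`. [this work] -/
def soloInformedTorsionG₁' (w : ℝ) : ℝ := 3 * (2 * w - 1) ^ 2 / w ^ 4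

/-- `1 − g₁(w) = Q(w)/w³`. [this work] -/
theorem soloInformed_one_sub_torsionG₁ {w : ℝ} (hw : w ≠ 0) :
    1 - soloInformedTorsionG₁ w = soloInformedTorsionQ w / w ^ 3 := by
  unfold soloInformedTorsionG₁ soloInformedTorsionQ
  field_simp
  ring

/-- The derivative of `g₁` away from `0`. [this work] -/
theorem soloInformed_hasDerivAt_torsionG₁ {w : ℝ} (hw : w ≠ 0) :
    HasDerivAt soloInformedTorsionG₁ (soloInformedTorsionG₁' w) w := by
  have hl : HasDerivAt (fun y : ℝ => 2 * y - 1) 2 w := by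
    simpa using ((hasDerivAt_id' w).const_mul (2:ℝ)).sub_const 1
  have h := (hl.fun_pow 3).fun_div ((hasDerivAt_id' w).fun_pow 3) (pow_ne_zero 3 hw)
  have hfun : soloInformedTorsionG₁ = fun y : ℝ => (2 * y - 1) ^ 3 / y ^ 3 := rfl
  rw [hfun]
  refine h.congr_deriv ?_
  unfold soloInformedTorsionG₁'
  rw [div_eq_div_iff (pow_ne_zero _ (pow_ne_zero _ hw)) (pow_ne_zero _ hw)]
  simp only [Nat.cast_ofNat, show (3 - 1 : ℕ) = 2 from rfl, mul_one]
  ring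

/-- `g₁` is continuous on `[½, 1]`. [this work] -/
theorem soloInformed_continuousOn_torsionG₁ :
    ContinuousOn soloInformedTorsionG₁ (Icc (1 / 2 : ℝ) 1) := fun t ht =>
  (soloInformed_hasDerivAt_torsionG₁ (show t ≠ 0 by linarith [ht.1])).continuousAt
    |>.continuousWithinAt

/-- `g₁' > 0` on `(½, 1)`. [this work] -/
theorem soloInformed_torsionG₁'_pos {w : ℝ} (h : 1 / 2 < w) :
    0 < soloInformedTorsionG₁' w := by
  unfold soloInformedTorsionG₁'
  have h1 : 0 < 2 * w - 1 := by linarith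
  have h2 : 0 < w := by linarith
  positivity

/-- `g₁` maps `(½,1)` into `(0,1)`. [this work] -/
theorem soloInformed_torsionG₁_mem {w : ℝ} (h : 1 / 2 < w) (h1 : w < 1) :
    soloInformedTorsionG₁ w ∈ Ioo (0:ℝ) 1 := by
  unfold soloInformedTorsionG₁
  have h0 : 0 < 2 * w - 1 := by linarith
  have hw : 0 < w := by linarith
  refine ⟨by positivity, (div_lt_one (by positivity)).2 ?_⟩
  exact pow_lt_pow_left₀ (by linarith) h0.le three_ne_zero

/-- `g₁` is injective on `(½,1)` and maps it onto `(0,1)`. [this work] -/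
theorem soloInformed_torsionG₁_subst :
    InjOn soloInformedTorsionG₁ (Ioo (1 / 2 : ℝ) 1) ∧
      soloInformedTorsionG₁ '' Ioo (1 / 2 : ℝ) 1 = Ioo (0:ℝ) 1 :=
  soloInformed_Ioo_substitution (by norm_num) soloInformed_continuousOn_torsionG₁
    (fun t ht => soloInformed_hasDerivAt_torsionG₁ (show t ≠ 0 by linarith [ht.1]))
    (fun t ht => (soloInformed_torsionG₁'_pos ht.1).ne')
    (fun _ hw => soloInformed_torsionG₁_mem hw.1 hw.2)
    (Or.inl ⟨by norm_num [soloInformedTorsionG₁], by norm_num [soloInformedTorsionG₁]⟩)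

/-- The lift of `g₁` is a `ℚ`-semialgebraic map on any semialgebraic set avoiding `w = 0`.
[this work] -/
theorem soloInformed_isSemialgebraicMapOn_lift_torsionG₁ {D : Set (Fin 1 → ℝ)}
    (hD : IsSemialgebraic ℚ D) (hD0 : ∀ x ∈ D, x 0 ≠ 0) :
    IsSemialgebraicMapOn ℚ D (soloInformedLift soloInformedTorsionG₁) := by
  refine IsSemialgebraicMapOn.of_forall hD fun j => ?_
  refine (isSemialgebraicFunOn_aeval_div_aeval hD
    ((MvPolynomial.C 2 * MvPolynomial.X 0 - 1) ^ 3) (MvPolynomial.X 0 ^ 3)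
    fun x hx => ?_).congr fun x hx => ?_
  · simpa using pow_ne_zero 3 (hD0 x hx)
  · simp [soloInformedLift, soloInformedTorsionG₁]

/-- **Integrand identity of lift 1**: for `w ∈ (½,1)`,
`3 w^{−1/2} Q(w)^{−1/2} = g₁(w)^{1/3−1} (1 − g₁(w))^{1/2−1} |g₁'(w)|`
(sixth powers: `729 w⁻³ Q⁻³ = g₁⁻⁴ (Q/w³)⁻³ g₁'⁶`). [this work] -/
theorem soloInformed_torsion_lift₁_identity {w : ℝ} (h : 1 / 2 < w) (h1 : w < 1) :
    ((3 : ℚ) : ℝ) * (w ^ (-1 / 2 : ℝ) * soloInformedTorsionQ w ^ (-1 / 2 : ℝ)) =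
      (soloInformedTorsionG₁ w) ^ (((1 / 3 : ℚ) : ℝ) - 1) *
        (1 - soloInformedTorsionG₁ w) ^ (((1 / 2 : ℚ) : ℝ) - 1) *
          |soloInformedTorsionG₁' w| := by
  have hw : 0 < w := by linarith
  have hQ : 0 < soloInformedTorsionQ w := soloInformed_torsionQ_pos h1
  have hg := soloInformed_torsionG₁_mem h h1
  have hg0 : 0 < soloInformedTorsionG₁ w := hg.1
  have hg1 : 0 < 1 - soloInformedTorsionG₁ w := sub_pos.2 hg.2
  have hg' : 0 < soloInformedTorsionG₁' w := soloInformed_torsionG₁'_pos h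
  rw [abs_of_pos hg']
  push_cast
  rw [← pow_left_inj₀ (by positivity) (by positivity) (by norm_num : (6:ℕ) ≠ 0)]
  simp only [mul_pow]
  rw [soloInformed_rpow_pow_six hw _ 3 (by norm_num),
    soloInformed_rpow_pow_six hQ _ 3 (by norm_num),
    soloInformed_rpow_pow_six hg0 _ 4 (by norm_num),
    soloInformed_rpow_pow_six hg1 _ 3 (by norm_num),
    soloInformed_one_sub_torsionG₁ hw.ne']
  unfold soloInformedTorsionG₁ soloInformedTorsionG₁'
  have h2 : 2 * w - 1 ≠ 0 := by linarith
  have h2' : w * 2 - 1 ≠ 0 := fun e => h2 (by linarith)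
  have hw' : w ≠ 0 := hw.ne'
  have hQ' : soloInformedTorsionQ w ≠ 0 := hQ.ne'
  field_simp

/-- **Lift 1 (rule 2).** For `U` the upper half `(½,1)` of the master representation `M₃` and
a pinned `B = β(⅓,½)`, the substitution `t = g₁(w)` gives `[U] − [B] ∈ changeOfVariablesRel`.
[Kontsevich–Zagier 2001, §1.2; this work] -/
theorem soloInformed_torsion_lift₁_mem_changeOfVariablesRel (U B : IntegralRep 1)
    (hUd : U.domain = {x | x 0 ∈ Ioo (1 / 2 : ℝ) 1})
    (hUi : EqOn U.integrand (soloInformedTorsionFun 3) U.domain)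
    (hBd : B.domain = {t | t 0 ∈ Ioo (0:ℝ) 1})
    (hBi : EqOn B.integrand
      (fun t => (t 0) ^ (((1 / 3 : ℚ) : ℝ) - 1) * (1 - t 0) ^ (((1 / 2 : ℚ) : ℝ) - 1))
      B.domain) :
    of U - of B ∈ changeOfVariablesRel := by
  refine soloInformed_lift_mem_changeOfVariablesRel U B hUd hBd ?_
    (fun t ht => soloInformed_hasDerivAt_torsionG₁ (show t ≠ 0 by linarith [ht.1]))
    soloInformed_torsionG₁_subst.1 soloInformed_torsionG₁_subst.2 fun x hx => ?_
  · rw [hUd]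
    exact soloInformed_isSemialgebraicMapOn_lift_torsionG₁ (hUd ▸ U.isSemialgebraic_domain)
      fun x hx => by
        have hx' : 1 / 2 < x 0 ∧ x 0 < 1 := hx
        linarith [hx'.1]
  · have hx' : 1 / 2 < x 0 ∧ x 0 < 1 := by rw [hUd] at hx; exact hx
    have hΦ : soloInformedLift soloInformedTorsionG₁ x ∈ B.domain := by
      rw [hBd]
      exact soloInformed_torsionG₁_mem hx'.1 hx'.2
    rw [hUi hx, hBi hΦ]
    dsimp only [soloInformedLift, soloInformedTorsionFun]
    exact soloInformed_torsion_lift₁_identity hx'.1 hx'.2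

/-! ### Lift 2: `M₃|_{(0,½)} → β(⅓,⅙)` by `g₂(w) = (1 − 2w)³/Q(w)` (decreasing) -/

/-- `g₂(w) = (1 − 2w)³ / Q(w)` (`= X³/(X³ + 1)` in the curve coordinate). [this work] -/
def soloInformedTorsionG₂ (w : ℝ) : ℝ := (1 - 2 * w) ^ 3 / soloInformedTorsionQ w

/-- `g₂'(w) = −3w²(1 − 2w)² / Q(w)²`. [this work] -/
def soloInformedTorsionG₂' (w : ℝ) : ℝ :=
  -(3 * w ^ 2 * (1 - 2 * w) ^ 2 / soloInformedTorsionQ w ^ 2)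

/-- `1 − g₂(w) = w³/Q(w)`. [this work] -/
theorem soloInformed_one_sub_torsionG₂ {w : ℝ} (hQ : soloInformedTorsionQ w ≠ 0) :
    1 - soloInformedTorsionG₂ w = w ^ 3 / soloInformedTorsionQ w := by
  unfold soloInformedTorsionG₂
  unfold soloInformedTorsionQ at hQ ⊢
  field_simp
  ring

/-- The derivative of `Q`. [this work] -/
theorem soloInformed_hasDerivAt_torsionQ (w : ℝ) :
    HasDerivAt soloInformedTorsionQ (-(6 * (1 - 2 * w) ^ 2) + 3 * w ^ 2) w := by
  have hl : HasDerivAt (fun y : ℝ => 1 - 2 * y) (-2) w := by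
    simpa using ((hasDerivAt_id' w).const_mul (2:ℝ)).const_sub 1
  have h := (hl.fun_pow 3).fun_add ((hasDerivAt_id' w).fun_pow 3)
  have hfun : soloInformedTorsionQ = fun y : ℝ => (1 - 2 * y) ^ 3 + y ^ 3 := rfl
  rw [hfun]
  refine h.congr_deriv ?_
  simp only [Nat.cast_ofNat, show (3 - 1 : ℕ) = 2 from rfl, mul_one]
  ring

/-- The derivative of `g₂` (where `Q ≠ 0`). [this work] -/
theorem soloInformed_hasDerivAt_torsionG₂ {w : ℝ} (hQ : soloInformedTorsionQ w ≠ 0) :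
    HasDerivAt soloInformedTorsionG₂ (soloInformedTorsionG₂' w) w := by
  have hl : HasDerivAt (fun y : ℝ => 1 - 2 * y) (-2) w := by
    simpa using ((hasDerivAt_id' w).const_mul (2:ℝ)).const_sub 1
  have h := (hl.fun_pow 3).fun_div (soloInformed_hasDerivAt_torsionQ w) hQ
  have hfun : soloInformedTorsionG₂ =
      fun y : ℝ => (1 - 2 * y) ^ 3 / soloInformedTorsionQ y := rfl
  rw [hfun]
  refine h.congr_deriv ?_
  unfold soloInformedTorsionG₂'
  simp only [Nat.cast_ofNat, show (3 - 1 : ℕ) = 2 from rfl]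
  unfold soloInformedTorsionQ at hQ ⊢
  field_simp
  ring

/-- `g₂` is continuous on `[0, ½]`. [this work] -/
theorem soloInformed_continuousOn_torsionG₂ :
    ContinuousOn soloInformedTorsionG₂ (Icc (0:ℝ) (1 / 2)) := fun t ht =>
  (soloInformed_hasDerivAt_torsionG₂ (soloInformed_torsionQ_pos
    (show t < 1 by linarith [ht.2])).ne').continuousAt.continuousWithinAt

/-- `g₂' < 0` on `(0, ½)`. [this work] -/
theorem soloInformed_torsionG₂'_neg {w : ℝ} (h0 : 0 < w) (h : w < 1 / 2) :
    soloInformedTorsionG₂' w < 0 := by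
  unfold soloInformedTorsionG₂'
  have h1 : 0 < 1 - 2 * w := by linarith
  have hQ : 0 < soloInformedTorsionQ w := soloInformed_torsionQ_pos (by linarith)
  have : 0 < 3 * w ^ 2 * (1 - 2 * w) ^ 2 / soloInformedTorsionQ w ^ 2 := by positivity
  linarith

/-- `g₂` maps `(0,½)` into `(0,1)`. [this work] -/
theorem soloInformed_torsionG₂_mem {w : ℝ} (h0 : 0 < w) (h : w < 1 / 2) :
    soloInformedTorsionG₂ w ∈ Ioo (0:ℝ) 1 := by
  have h1 : 0 < 1 - 2 * w := by linarith
  have hQ : 0 < soloInformedTorsionQ w := soloInformed_torsionQ_pos (by linarith)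
  refine ⟨by unfold soloInformedTorsionG₂; positivity, ?_⟩
  have h3 : 0 < 1 - soloInformedTorsionG₂ w := by
    rw [soloInformed_one_sub_torsionG₂ hQ.ne']
    positivity
  linarith

/-- `g₂` is injective on `(0,½)` and maps it onto `(0,1)` (`g₂(0) = 1`, `g₂(½) = 0`).
[this work] -/
theorem soloInformed_torsionG₂_subst :
    InjOn soloInformedTorsionG₂ (Ioo (0:ℝ) (1 / 2)) ∧
      soloInformedTorsionG₂ '' Ioo (0:ℝ) (1 / 2) = Ioo (0:ℝ) 1 :=
  soloInformed_Ioo_substitution (by norm_num) soloInformed_continuousOn_torsionG₂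
    (fun t ht => soloInformed_hasDerivAt_torsionG₂
      (soloInformed_torsionQ_pos (show t < 1 by linarith [ht.2])).ne')
    (fun t ht => (soloInformed_torsionG₂'_neg ht.1 ht.2).ne)
    (fun _ hw => soloInformed_torsionG₂_mem hw.1 hw.2)
    (Or.inr ⟨by norm_num [soloInformedTorsionG₂, soloInformedTorsionQ],
      by norm_num [soloInformedTorsionG₂, soloInformedTorsionQ]⟩)

/-- The lift of `g₂` is a `ℚ`-semialgebraic map on any semialgebraic set inside `{w < 1}`.
[this work] -/
theorem soloInformed_isSemialgebraicMapOn_lift_torsionG₂ {D : Set (Fin 1 → ℝ)}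
    (hD : IsSemialgebraic ℚ D) (hD1 : ∀ x ∈ D, x 0 < 1) :
    IsSemialgebraicMapOn ℚ D (soloInformedLift soloInformedTorsionG₂) := by
  refine IsSemialgebraicMapOn.of_forall hD fun j => ?_
  refine (isSemialgebraicFunOn_aeval_div_aeval hD
    ((1 - MvPolynomial.C 2 * MvPolynomial.X 0) ^ 3)
    ((1 - MvPolynomial.C 2 * MvPolynomial.X 0) ^ 3 + MvPolynomial.X 0 ^ 3)
    fun x hx => ?_).congr fun x hx => ?_
  · have h := (soloInformed_torsionQ_pos (hD1 x hx)).ne'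
    unfold soloInformedTorsionQ at h
    simpa using h
  · simp [soloInformedLift, soloInformedTorsionG₂, soloInformedTorsionQ]

/-- **Integrand identity of lift 2**: for `w ∈ (0,½)`,
`3 w^{−1/2} Q(w)^{−1/2} = g₂(w)^{1/3−1} (1 − g₂(w))^{1/6−1} |g₂'(w)|`
(sixth powers: `729 w⁻³ Q⁻³ = g₂⁻⁴ (w³/Q)⁻⁵ (3w²(1−2w)²/Q²)⁶`). [this work] -/
theorem soloInformed_torsion_lift₂_identity {w : ℝ} (h0 : 0 < w) (h : w < 1 / 2) :
    ((3 : ℚ) : ℝ) * (w ^ (-1 / 2 : ℝ) * soloInformedTorsionQ w ^ (-1 / 2 : ℝ)) =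
      (soloInformedTorsionG₂ w) ^ (((1 / 3 : ℚ) : ℝ) - 1) *
        (1 - soloInformedTorsionG₂ w) ^ (((1 / 6 : ℚ) : ℝ) - 1) *
          |soloInformedTorsionG₂' w| := by
  have h12 : 0 < 1 - 2 * w := by linarith
  have hQ : 0 < soloInformedTorsionQ w := soloInformed_torsionQ_pos (by linarith)
  have hg := soloInformed_torsionG₂_mem h0 h
  have hg0 : 0 < soloInformedTorsionG₂ w := hg.1
  have hg1 : 0 < 1 - soloInformedTorsionG₂ w := sub_pos.2 hg.2
  rw [abs_of_neg (soloInformed_torsionG₂'_neg h0 h)]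
  unfold soloInformedTorsionG₂'
  rw [neg_neg]
  push_cast
  rw [← pow_left_inj₀ (by positivity) (by positivity) (by norm_num : (6:ℕ) ≠ 0)]
  simp only [mul_pow]
  rw [soloInformed_rpow_pow_six h0 _ 3 (by norm_num),
    soloInformed_rpow_pow_six hQ _ 3 (by norm_num),
    soloInformed_rpow_pow_six hg0 _ 4 (by norm_num),
    soloInformed_rpow_pow_six hg1 _ 5 (by norm_num),
    soloInformed_one_sub_torsionG₂ hQ.ne']
  unfold soloInformedTorsionG₂
  have h2 : 1 - 2 * w ≠ 0 := h12.ne'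
  have h2' : 1 - w * 2 ≠ 0 := fun e => h2 (by linarith)
  have hw' : w ≠ 0 := h0.ne'
  have hQ' : soloInformedTorsionQ w ≠ 0 := hQ.ne'
  field_simp

/-- **Lift 2 (rule 2).** For `L` the lower half `(0,½)` of the master representation `M₃` and
a pinned `B = β(⅓,⅙)`, the substitution `t = g₂(w)` gives `[L] − [B] ∈ changeOfVariablesRel`.
[Kontsevich–Zagier 2001, §1.2; this work] -/
theorem soloInformed_torsion_lift₂_mem_changeOfVariablesRel (L B : IntegralRep 1)
    (hLd : L.domain = {x | x 0 ∈ Ioo (0:ℝ) (1 / 2)})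
    (hLi : EqOn L.integrand (soloInformedTorsionFun 3) L.domain)
    (hBd : B.domain = {t | t 0 ∈ Ioo (0:ℝ) 1})
    (hBi : EqOn B.integrand
      (fun t => (t 0) ^ (((1 / 3 : ℚ) : ℝ) - 1) * (1 - t 0) ^ (((1 / 6 : ℚ) : ℝ) - 1))
      B.domain) :
    of L - of B ∈ changeOfVariablesRel := by
  refine soloInformed_lift_mem_changeOfVariablesRel L B hLd hBd ?_
    (fun t ht => soloInformed_hasDerivAt_torsionG₂
      (soloInformed_torsionQ_pos (show t < 1 by linarith [ht.2])).ne')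
    soloInformed_torsionG₂_subst.1 soloInformed_torsionG₂_subst.2 fun x hx => ?_
  · rw [hLd]
    exact soloInformed_isSemialgebraicMapOn_lift_torsionG₂ (hLd ▸ L.isSemialgebraic_domain)
      fun x hx => by
        have hx' : 0 < x 0 ∧ x 0 < 1 / 2 := hx
        linarith [hx'.2]
  · have hx' : 0 < x 0 ∧ x 0 < 1 / 2 := by rw [hLd] at hx; exact hx
    have hΦ : soloInformedLift soloInformedTorsionG₂ x ∈ B.domain := by
      rw [hBd]
      exact soloInformed_torsionG₂_mem hx'.1 hx'.2
    rw [hLi hx, hBi hΦ]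
    dsimp only [soloInformedLift, soloInformedTorsionFun]
    exact soloInformed_torsion_lift₂_identity hx'.1 hx'.2

end Summit.KontsevichZagierPeriods.KontsevichZagierPeriods.Theorems

end
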